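import Mathlib
import HarnessLib

/-!
# HodgeLocusCensusSymbolicCharts832 — the three all-λ chart certificates of the census cell (8,3,2) and their combined exceptional set {0, −1} (cell pub-hlocus, ENGINE B seat ivhs-2, gen 20)
HONEST FRAMING: certified instances and evidence bearing on the general Hodge conjecture; no claim.

SETTING (cell record `pub-hlocus-ivhs-2/MU0831-631-g20.md` §7, result M-832).  X_F = the Fermat cubic eightfold, P, P̌ the standard pair of 4-planes
meeting in a PLANE (census cell (8,3,2) = (c,d,k) = (2,3,4)), δ_λ = [P] + λ[P̌], V_λ its Hodge-locus germ, N = NL(P ∪ P̌), μ₀(λ) the multiplicity of V_λ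
along N at the general point.  The engine-B driver `gen20/symgermE.py` computes over ℚ(ζ₆)[λ] (z = ζ₆, z² = z − 1) the restricted Taylor coefficients of the
formal generic fibre of V_λ ∩ (X_s + Λ) along a general line in a CHART valid wherever the pivot determinant Δ(λ) ≠ 0, and the gcd G(λ) of the computed decisive
7 × 7 leading minors of the N = 3 Hilbert matrix; wherever Δ(λ₀)·G(λ₀) ≠ 0 the record concludes μ₀(8,3,2; λ₀) ≤ 3, hence = 3 with the λ-free lower bound
e ≥ 2 of Kloosterman 2025, Thm 1.3 (tree proposal `HodgeLocusCensusExcessLowerBound832`).  Both kernels A and B give the same polynomials up to units on every chart.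
THE THREE CHARTS (pivots chosen at λ* = 2, λ* = −z, λ* = 1 − z; exceptional polynomials Δ_i·G_i transcribed from
`gen20/out/S832E_{L2,Lmz,L1mz}_f5n120_AB_md4_N3.json`, where they split completely over the candidate roots):
  chart 1: (1 − z)·λ¹⁹⁹(λ + 1)³⁵(λ + z)⁵⁶(λ − 1 + z)³⁰       — exceptional set {0, −1, −z, 1 − z};
  chart 2: (1 − z)·λ¹⁹⁹(λ + 1)³⁵(λ − z + 1)⁵⁶(λ − 1 + z)³⁰   — exceptional set {0, −1, z − 1, 1 − z};
  chart 3: (z − 1)·λ¹⁵⁷(λ + 1)⁵⁰(λ + z)⁴³                   — exceptional set {0, −1, −z};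
  combined gcd (driver `--combine`): λ¹⁵⁷(λ + 1)³⁵.
WHAT THE KERNEL CHECKS HERE (field arithmetic over an arbitrary field K of characteristic 0 with an element z, z² = z − 1; no computation is replayed):
`chart1_decisive` (λ ∉ {0, −1, −z, 1 − z}), `chart2_decisive_at_neg_z`, `chart3_decisive_at_one_sub_z`, and `exceptional_set_eq_832`: the three exceptional
polynomials vanish SIMULTANEOUSLY iff λ ∈ {0, −1} — the certificate's exceptional set for (8,3,2) is exactly {0, −1} (λ = −1 is the cell's special value, where
the germ contains the transversal slice to order 4; λ = 0 is [P] alone; λ = 1 is NOT exceptional in this cell).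
NOT FORMALISED: the symbolic computation, the minor certificates, semicontinuity, the passage to μ₀, all Hodge theory.  Nothing here is a statement about the Hodge conjecture.
-/

namespace Summit.HodgeConjecture.HodgeConjecture.HodgeLocus.Census.SymbolicCharts832

variable {K : Type*} [Field K] [CharZero K]

/-! ## Units: irrationality facts about z = ζ₆ -/

/-- `z ≠ 0`. -/
theorem z_ne_zero {z : K} (hz : z ^ 2 = z - 1) : z ≠ 0 := by
  intro h; rw [h] at hz; norm_num at hz

/-- `1 − z ≠ 0`. -/
theorem one_sub_z_ne_zero {z : K} (hz : z ^ 2 = z - 1) : 1 - z ≠ 0 := by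
  intro h
  have hz' : z = 1 := by linear_combination -h
  rw [hz'] at hz; norm_num at hz

/-- `z − 1 ≠ 0`. -/
theorem z_sub_one_ne_zero {z : K} (hz : z ^ 2 = z - 1) : z - 1 ≠ 0 := by
  intro h
  have hz' : z = 1 := by linear_combination h
  rw [hz'] at hz; norm_num at hz

/-- `1 − 2z ≠ 0` (the two complex exceptional points `−z` and `z − 1` of charts 1 and 2 are distinct). -/
theorem one_sub_two_z_ne_zero {z : K} (hz : z ^ 2 = z - 1) : 1 - 2 * z ≠ 0 := by
  intro h
  have hz' : z = 1 / 2 := by linear_combination (-h) / 2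
  rw [hz'] at hz; norm_num at hz

/-- `2 − z ≠ 0`. -/
theorem two_sub_z_ne_zero {z : K} (hz : z ^ 2 = z - 1) : 2 - z ≠ 0 := by
  intro h
  have hz' : z = 2 := by linear_combination -h
  rw [hz'] at hz; norm_num at hz

/-! ## The three exceptional polynomials (literal transcription of the split forms) -/

/-- Chart 1 (λ* = 2): `Δ₁·G₁ = (1 − z)·λ¹⁹⁹(λ + 1)³⁵(λ + z)⁵⁶(λ − 1 + z)³⁰`. -/
def exc832c1 (z lam : K) : K := (1 - z) * lam ^ 199 * (lam + 1) ^ 35 * (lam + z) ^ 56 * (lam - 1 + z) ^ 30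

/-- Chart 2 (λ* = −z): `Δ₂·G₂ = (1 − z)·λ¹⁹⁹(λ + 1)³⁵(λ − z + 1)⁵⁶(λ − 1 + z)³⁰`. -/
def exc832c2 (z lam : K) : K := (1 - z) * lam ^ 199 * (lam + 1) ^ 35 * (lam - z + 1) ^ 56 * (lam - 1 + z) ^ 30

/-- Chart 3 (λ* = 1 − z): `Δ₃·G₃ = (z − 1)·λ¹⁵⁷(λ + 1)⁵⁰(λ + z)⁴³`. -/
def exc832c3 (z lam : K) : K := (z - 1) * lam ^ 157 * (lam + 1) ^ 50 * (lam + z) ^ 43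

/-- The combined certificate polynomial (gcd of the three): `λ¹⁵⁷(λ + 1)³⁵`. -/
def exc832 (lam : K) : K := lam ^ 157 * (lam + 1) ^ 35

/-! ## Decisiveness -/

/-- Chart 1 decides every `λ ∉ {0, −1, −z, 1 − z}`. -/
theorem chart1_decisive {z lam : K} (hz : z ^ 2 = z - 1) (h0 : lam ≠ 0) (hm1 : lam ≠ -1) (hmz : lam ≠ -z)
    (h1mz : lam ≠ 1 - z) : exc832c1 z lam ≠ 0 := by
  have hp1 : lam + 1 ≠ 0 := fun h => hm1 (by linear_combination h)
  have hpz : lam + z ≠ 0 := fun h => hmz (by linear_combination h)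
  have hq : lam - 1 + z ≠ 0 := fun h => h1mz (by linear_combination h)
  unfold exc832c1
  exact mul_ne_zero (mul_ne_zero (mul_ne_zero (mul_ne_zero (one_sub_z_ne_zero hz) (pow_ne_zero 199 h0))
    (pow_ne_zero 35 hp1)) (pow_ne_zero 56 hpz)) (pow_ne_zero 30 hq)

/-- Chart 2 decides `λ = −z`. -/
theorem chart2_decisive_at_neg_z {z : K} (hz : z ^ 2 = z - 1) : exc832c2 z (-z) ≠ 0 := by
  have h0 : (-z : K) ≠ 0 := neg_ne_zero.mpr (z_ne_zero hz)
  have hp1 : (-z : K) + 1 ≠ 0 := by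
    intro h; exact one_sub_z_ne_zero hz (by linear_combination h)
  have hmid : (-z : K) - z + 1 ≠ 0 := by
    intro h; exact one_sub_two_z_ne_zero hz (by linear_combination h)
  have hq : (-z : K) - 1 + z ≠ 0 := by
    intro h
    have h' : (-1 : K) = 0 := by linear_combination h
    norm_num at h'
  unfold exc832c2
  exact mul_ne_zero (mul_ne_zero (mul_ne_zero (mul_ne_zero (one_sub_z_ne_zero hz) (pow_ne_zero 199 h0))
    (pow_ne_zero 35 hp1)) (pow_ne_zero 56 hmid)) (pow_ne_zero 30 hq)

/-- Chart 3 decides `λ = 1 − z`. -/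
theorem chart3_decisive_at_one_sub_z {z : K} (hz : z ^ 2 = z - 1) : exc832c3 z (1 - z) ≠ 0 := by
  have h0 : (1 - z : K) ≠ 0 := one_sub_z_ne_zero hz
  have hp1 : (1 - z : K) + 1 ≠ 0 := by
    intro h; exact two_sub_z_ne_zero hz (by linear_combination h)
  have hpz : (1 - z : K) + z ≠ 0 := by
    intro h
    have h' : (1 : K) = 0 := by linear_combination h
    norm_num at h'
  unfold exc832c3
  exact mul_ne_zero (mul_ne_zero (mul_ne_zero (z_sub_one_ne_zero hz) (pow_ne_zero 157 h0)) (pow_ne_zero 50 hp1))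
    (pow_ne_zero 43 hpz)

/-! ## The exceptional set of the (8,3,2) certificate is exactly {0, −1} -/

omit [CharZero K] in
/-- All three exceptional polynomials vanish at `λ = 0` and at `λ = −1`. -/
theorem exc832_vanish (z : K) :
    (exc832c1 z 0 = 0 ∧ exc832c2 z 0 = 0 ∧ exc832c3 z 0 = 0) ∧
      (exc832c1 z (-1) = 0 ∧ exc832c2 z (-1) = 0 ∧ exc832c3 z (-1) = 0) := by
  unfold exc832c1 exc832c2 exc832c3
  refine ⟨⟨by simp, by simp, by simp⟩, ⟨by simp, by simp, by simp⟩⟩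

/-- The three chart certificates of cell (8,3,2) fail simultaneously exactly on `{0, −1}`: for every other `λ` at least one chart certifies
`μ₀(8,3,2; λ) ≤ 3` (record M-832). -/
theorem exceptional_set_eq_832 {z lam : K} (hz : z ^ 2 = z - 1) :
    (exc832c1 z lam = 0 ∧ exc832c2 z lam = 0 ∧ exc832c3 z lam = 0) ↔ (lam = 0 ∨ lam = -1) := by
  constructor
  · rintro ⟨h₁, h₂, h₃⟩
    by_contra hne
    push Not at hne
    by_cases hmz : lam = -z
    · subst hmz; exact chart2_decisive_at_neg_z hz h₂
    · by_cases h1mz : lam = 1 - z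
      · subst h1mz; exact chart3_decisive_at_one_sub_z hz h₃
      · exact chart1_decisive hz hne.1 hne.2 hmz h1mz h₁
  · rintro (rfl | rfl)
    · exact (exc832_vanish z).1
    · exact (exc832_vanish z).2

omit [CharZero K] in
/-- The combined polynomial `λ¹⁵⁷(λ + 1)³⁵` has the same zero set `{0, −1}`. -/
theorem exc832_eq_zero_iff (lam : K) : exc832 lam = 0 ↔ (lam = 0 ∨ lam = -1) := by
  unfold exc832
  constructor
  · intro h
    rcases mul_eq_zero.mp h with h | h
    · exact Or.inl (pow_eq_zero_iff (by norm_num) |>.mp h)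
    · exact Or.inr (by have := pow_eq_zero_iff (n := 35) (by norm_num) |>.mp h; linear_combination this)
  · rintro (rfl | rfl) <;> simp

end Summit.HodgeConjecture.HodgeConjecture.HodgeLocus.Census.SymbolicCharts832
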